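import Mathlib

/-!
# Exponent-three groups as `ZMod 3`-modules: independence from distinct subset sums

First plumbing lemma of the kernel plan for the type model (solo-blind programme, K3.35):
in an additive commutative group of exponent three, a finite family with pairwise distinct
subset sums is linearly independent over `ZMod 3` (for the module structure
`AddCommGroup.zmodModule`).  This is what allows a subset-sum-distinct block `B` to be
extended to a `ZMod 3`-basis, with respect to which coordinates ("types") are read off.
Nothing here bears on `ω`.
-/

namespace Summit.MatrixMultiplication.MatrixMultiplication.Theorems

open Finset

variable {G : Type*} [AddCommGroup G] {ι : Type*}

/-- Trichotomy in `ZMod 3`. -/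
theorem soloBlind_zmod3_trichotomy (c : ZMod 3) : c = 0 ∨ c = 1 ∨ c = 2 := by
  revert c; decide

/-- In a `ZMod 3`-module, `2 • g = -g`. -/
theorem soloBlind_two_smul_eq_neg [Module (ZMod 3) G] (g : G) : (2 : ZMod 3) • g = -g := by
  have h3 : (3 : ZMod 3) • g = 0 := by
    rw [show (3 : ZMod 3) = 0 by decide, zero_smul]
  have h21 : (3 : ZMod 3) • g = (2 : ZMod 3) • g + g := by
    rw [show (3 : ZMod 3) = 2 + 1 by decide, add_smul, one_smul]
  rw [h21] at h3
  exact eq_neg_of_add_eq_zero_left h3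

/-- Distinct subset sums on `B` imply linear independence over `ZMod 3` of the family
`fun i : B => h i`, for any `ZMod 3`-module structure on `G`. -/
theorem soloBlind_linearIndependent_of_subsetSum_inj [Module (ZMod 3) G] (h : ι → G)
    (B : Finset ι)
    (hdist : ∀ T ⊆ B, ∀ T' ⊆ B, ∑ i ∈ T, h i = ∑ i ∈ T', h i → T = T') :
    LinearIndependent (ZMod 3) (fun i : B => h i) := by
  classical
  rw [Fintype.linearIndependent_iff]
  intro g hg
  -- split the coefficients into the `1`-part and the `2`-part
  set T₁ : Finset ι := (B.attach.filter fun i => g i = 1).map (Function.Embedding.subtype _) with hT₁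
  set T₂ : Finset ι := (B.attach.filter fun i => g i = 2).map (Function.Embedding.subtype _) with hT₂
  have hT₁B : T₁ ⊆ B := by
    intro i hi
    simp only [hT₁, mem_map, mem_filter, mem_attach, true_and, Function.Embedding.coe_subtype]
      at hi
    obtain ⟨j, -, rfl⟩ := hi
    exact j.2
  have hT₂B : T₂ ⊆ B := by
    intro i hi
    simp only [hT₂, mem_map, mem_filter, mem_attach, true_and, Function.Embedding.coe_subtype]
      at hi
    obtain ⟨j, -, rfl⟩ := hi
    exact j.2
  -- the relation reads `∑_{T₁} h - ∑_{T₂} h = 0`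
  have hsum : ∑ i : B, g i • h i = ∑ i ∈ T₁, h i - ∑ i ∈ T₂, h i := by
    have hsplit : ∀ i : B, g i • h i
        = (if g i = 1 then h i else 0) - (if g i = 2 then h i else 0) := by
      intro i
      have h01 : (0 : ZMod 3) ≠ 1 := by decide
      have h02 : (0 : ZMod 3) ≠ 2 := by decide
      have h12 : (1 : ZMod 3) ≠ 2 := by decide
      have h21 : (2 : ZMod 3) ≠ 1 := by decide
      rcases soloBlind_zmod3_trichotomy (g i) with hc | hc | hc
      · rw [hc, zero_smul]; simp [h01, h02]
      · rw [hc, one_smul]; simp [h12]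
      · rw [hc, soloBlind_two_smul_eq_neg]; simp [h21]
    rw [Finset.sum_congr rfl fun i _ => hsplit i, Finset.sum_sub_distrib]
    congr 1
    · rw [hT₁, Finset.sum_map, Finset.sum_filter]
      simp only [Function.Embedding.coe_subtype]
      rfl
    · rw [hT₂, Finset.sum_map, Finset.sum_filter]
      simp only [Function.Embedding.coe_subtype]
      rfl
  have heq : ∑ i ∈ T₁, h i = ∑ i ∈ T₂, h i := by
    rw [hsum] at hg
    exact sub_eq_zero.mp hg
  have hTT : T₁ = T₂ := hdist T₁ hT₁B T₂ hT₂B heq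
  -- but `T₁` and `T₂` are disjoint, hence both empty
  intro i
  by_contra hne
  have hmem : ∀ c : ZMod 3, g i = c → c = 1 ∨ c = 2 → False := by
    intro c hc h12
    rcases h12 with rfl | rfl
    · have hi1 : (i : ι) ∈ T₁ := by
        simp only [hT₁, mem_map, mem_filter, mem_attach, true_and, Function.Embedding.coe_subtype]
        exact ⟨i, hc, rfl⟩
      rw [hTT] at hi1
      simp only [hT₂, mem_map, mem_filter, mem_attach, true_and, Function.Embedding.coe_subtype]
        at hi1
      obtain ⟨j, hj, hji⟩ := hi1
      have : j = i := Subtype.ext hji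
      subst this
      rw [hc] at hj
      exact absurd hj (by decide)
    · have hi2 : (i : ι) ∈ T₂ := by
        simp only [hT₂, mem_map, mem_filter, mem_attach, true_and, Function.Embedding.coe_subtype]
        exact ⟨i, hc, rfl⟩
      rw [← hTT] at hi2
      simp only [hT₁, mem_map, mem_filter, mem_attach, true_and, Function.Embedding.coe_subtype]
        at hi2
      obtain ⟨j, hj, hji⟩ := hi2
      have : j = i := Subtype.ext hji
      subst this
      rw [hc] at hj
      exact absurd hj (by decide)
  have hcases : g i = 0 ∨ g i = 1 ∨ g i = 2 := soloBlind_zmod3_trichotomy (g i)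
  rcases hcases with h0 | h1 | h2
  · exact hne h0
  · exact hmem 1 h1 (Or.inl rfl)
  · exact hmem 2 h2 (Or.inr rfl)

/-- The exponent-three hypothesis in the `nsmul` form consumed by `AddCommGroup.zmodModule`. -/
theorem soloBlind_three_nsmul (three : ∀ g : G, 3 • g = 0) : ∀ x : G, 3 • x = 0 := three

/-- Packaging: under `three`, with the canonical `ZMod 3`-module structure, a subset-sum-distinct
block is linearly independent.  (The module structure is introduced locally, never as a global
instance.) -/
theorem soloBlind_linearIndependent_of_three (three : ∀ g : G, 3 • g = 0) (h : ι → G)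
    (B : Finset ι)
    (hdist : ∀ T ⊆ B, ∀ T' ⊆ B, ∑ i ∈ T, h i = ∑ i ∈ T', h i → T = T') :
    letI : Module (ZMod 3) G := AddCommGroup.zmodModule three
    LinearIndependent (ZMod 3) (fun i : B => h i) := by
  letI : Module (ZMod 3) G := AddCommGroup.zmodModule three
  exact soloBlind_linearIndependent_of_subsetSum_inj h B hdist

end Summit.MatrixMultiplication.MatrixMultiplication.Theorems
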